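/-
Copyright: harness tree, Literature layer (sorry-free). b2b-lace enum2-g12 (ENUMERATION SHARD B gen 12),
GAPS G8 (δ2)(i), SEEDCERT_U L2 (half-angle form of the 1-D continuous-time SRW kernel).
-/
import Literature.Probability.LatticeModels.SRWHeatKernel1D
import Mathlib.Analysis.SpecialFunctions.Trigonometric.Chebyshev.Basic
import Mathlib.MeasureTheory.Function.JacobianOneDim
import HarnessLib

/-!
# The half-angle (Chebyshev) form of the continuous-time SRW kernel `q_t(m) = e^{-t} I_m(t)`

For the Fourier-form kernel `srwHeatKernel t m = (1/2π) ∫_{-π}^{π} cos(km) e^{-t(1-cos k)} dk` of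
`SRWHeatKernel1D.lean` (`= e^{-t} I_m(t)`, the function `F(t,d,m)` of Fitzner–van der Hofstad
[NoBLE17, (5.2)] at `t/d`), this file proves

* `srwHeatKernel_eq_integral_zero_pi` — `q_t(m) = (1/π) ∫₀^π cos(km) e^{-t(1-cos k)} dk`
  (evenness of the integrand);
* `srwHeatKernel_eq_integral_halfAngle` — the **half-angle form**
  `q_t(m) = (2/π) ∫₀¹ e^{-2ts²} T_m(1-2s²) (1-s²)^{-1/2} ds`
  (`s = sin(k/2)`, `cos k = 1 - 2s²`, `cos(mk) = T_m(cos k)` with the Chebyshev polynomial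
  `Polynomial.Chebyshev.T ℝ m`, `dk = 2 ds/√(1-s²)`), by the change-of-variables formula
  `MeasureTheory.integral_image_eq_integral_abs_deriv_smul` for the injective map `k ↦ sin(k/2)`
  on `(0,π)` (no continuity of the `s`-integrand at `s = 1` is needed).

This is the form in which the large-`t` two-sided brackets of `q_t(m)` are derived (expand
`(1-s²)^{-1/2}` by `InvSqrtOneSubBracket`, bound `|T_m| ≤ 1`, integrate Gaussian moments): the
entrance of the `BesselBracket` layer of the seed certificates for the SRW integrals
`I_{n,0}(x;d)` [NoBLE17, §5.1.1].  `d`-free, table-free.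

References: R. Fitzner, R. van der Hofstad, Electron. J. Probab. 22 (2017), §5.1.1 (5.2), p. 1089
(`F(t,d,n) = e^{-t/d} I_n(t/d)`). [cite: FitznerVanDerHofstad2016NoBLE, §5.1.1 (5.2) p. 1089];
T. Hara, G. Slade, Rev. Math. Phys. 4 (1992), Appendix B (evaluation of the SRW Bessel integrals).
[cite: HaraSlade1992b, Appendix B]; G. N. Watson, *A Treatise on the Theory of Bessel Functions*
(1944), §3.71 (9) (`I_n(z) = (1/π)∫₀^π e^{z cos θ} cos nθ dθ`). [cite: Watson1944, §3.71 (9)]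
-/


noncomputable section

open Real MeasureTheory Set Polynomial.Chebyshev

namespace Literature.Probability.LatticeModels

/-- The integrand of `srwHeatKernel`. [folklore] -/
def srwHeatIntegrandReal (t : ℝ) (m : ℤ) (k : ℝ) : ℝ :=
  Real.cos (k * m) * Real.exp (-(t * (1 - Real.cos k)))

/-- The integrand is continuous in `k`. [folklore] -/
theorem continuous_srwHeatIntegrandReal (t : ℝ) (m : ℤ) :
    Continuous (srwHeatIntegrandReal t m) := by
  unfold srwHeatIntegrandReal; fun_prop

/-- The integrand is even in `k`. [folklore] -/
theorem srwHeatIntegrandReal_neg (t : ℝ) (m : ℤ) (k : ℝ) :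
    srwHeatIntegrandReal t m (-k) = srwHeatIntegrandReal t m k := by
  simp [srwHeatIntegrandReal, neg_mul, Real.cos_neg]

/-- `srwHeatKernel` unfolded with the named integrand. [folklore] -/
theorem srwHeatKernel_eq_div (t : ℝ) (m : ℤ) :
    srwHeatKernel t m = (∫ k in (-π)..π, srwHeatIntegrandReal t m k) / (2 * π) := rfl

/-- **`[0,π]` form**: `q_t(m) = (1/π) ∫₀^π cos(km) e^{-t(1-cos k)} dk`. [cite: Watson1944, §3.71 (9)] -/
theorem srwHeatKernel_eq_integral_zero_pi (t : ℝ) (m : ℤ) :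
    srwHeatKernel t m = (∫ k in (0 : ℝ)..π, srwHeatIntegrandReal t m k) / π := by
  rw [srwHeatKernel_eq_div]
  have hc := continuous_srwHeatIntegrandReal t m
  have hneg : ∫ k in (-π)..0, srwHeatIntegrandReal t m k
      = ∫ k in (0 : ℝ)..π, srwHeatIntegrandReal t m k := by
    have h := intervalIntegral.integral_comp_neg (a := 0) (b := π) (srwHeatIntegrandReal t m)
    rw [neg_zero] at h
    rw [← h]
    exact intervalIntegral.integral_congr fun k _ => srwHeatIntegrandReal_neg t m k
  rw [← intervalIntegral.integral_add_adjacent_intervals (hc.intervalIntegrable (-π) 0)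
    (hc.intervalIntegrable 0 π), hneg, ← two_mul, mul_div_mul_left _ _ (two_ne_zero)]

/-! ## The change of variables `s = sin(k/2)` -/

/-- `cos k = 1 - 2 sin²(k/2)`. [folklore] -/
theorem cos_eq_one_sub_two_mul_sin_half_sq (k : ℝ) :
    Real.cos k = 1 - 2 * Real.sin (k / 2) ^ 2 := by
  have h : Real.cos (2 * (k / 2)) = 2 * Real.cos (k / 2) ^ 2 - 1 := Real.cos_two_mul (k / 2)
  rw [show 2 * (k / 2) = k by ring, Real.cos_sq'] at h
  linarith

/-- `k ↦ sin(k/2)` is injective on `(0,π)`. [folklore] -/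
theorem injOn_sin_half : InjOn (fun k : ℝ => Real.sin (k / 2)) (Ioo 0 π) := by
  intro a ha b hb hab
  have ha' : a / 2 ∈ Icc (-(π / 2)) (π / 2) := by
    constructor <;> nlinarith [ha.1, ha.2, Real.pi_pos]
  have hb' : b / 2 ∈ Icc (-(π / 2)) (π / 2) := by
    constructor <;> nlinarith [hb.1, hb.2, Real.pi_pos]
  have h := Real.injOn_sin ha' hb' hab
  linarith

/-- `0 < sin(k/2) < 1` for `k ∈ (0,π)`. [folklore] -/
theorem sin_half_mem_Ioo {k : ℝ} (hk : k ∈ Ioo 0 π) : Real.sin (k / 2) ∈ Ioo 0 1 := by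
  refine ⟨Real.sin_pos_of_pos_of_lt_pi (by linarith [hk.1]) (by linarith [hk.2, Real.pi_pos]), ?_⟩
  have h := Real.sin_lt_sin_of_lt_of_le_pi_div_two (x := k / 2) (y := π / 2)
    (by linarith [hk.1, Real.pi_pos]) le_rfl (by linarith [hk.2])
  rwa [Real.sin_pi_div_two] at h

/-- `0 < cos(k/2)` for `k ∈ (0,π)`. [folklore] -/
theorem cos_half_pos {k : ℝ} (hk : k ∈ Ioo 0 π) : 0 < Real.cos (k / 2) :=
  Real.cos_pos_of_mem_Ioo ⟨by linarith [hk.1, Real.pi_pos], by linarith [hk.2]⟩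

/-- `sin(·/2)` maps `(0,π)` onto `(0,1)`. [folklore] -/
theorem image_sin_half_Ioo : (fun k : ℝ => Real.sin (k / 2)) '' Ioo 0 π = Ioo 0 1 := by
  apply Subset.antisymm
  · rintro s ⟨k, hk, rfl⟩
    exact sin_half_mem_Ioo hk
  · have hcont : ContinuousOn (fun k : ℝ => Real.sin (k / 2)) (Icc 0 π) :=
      (Real.continuous_sin.comp (continuous_id.div_const 2)).continuousOn
    have h := intermediate_value_Ioo Real.pi_pos.le hcont
    simp only [zero_div, Real.sin_zero, Real.sin_pi_div_two] at h
    exact h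

/-- The `s`-integrand of the half-angle form:
`G(s) = e^{-2ts²} T_m(1-2s²) / √(1-s²)`. [folklore] -/
def halfAngleIntegrand (t : ℝ) (m : ℤ) (s : ℝ) : ℝ :=
  Real.exp (-(2 * t * s ^ 2)) * (T ℝ m).eval (1 - 2 * s ^ 2) / √(1 - s ^ 2)

/-- Pointwise: for `k ∈ (0,π)`, `|cos(k/2)/2| · G(sin(k/2)) = ½ cos(km) e^{-t(1-cos k)}`. [folklore] -/
theorem abs_deriv_smul_halfAngleIntegrand {t : ℝ} {m : ℤ} {k : ℝ} (hk : k ∈ Ioo 0 π) :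
    |Real.cos (k / 2) / 2| • halfAngleIntegrand t m (Real.sin (k / 2))
      = (1 / 2 : ℝ) * srwHeatIntegrandReal t m k := by
  have hc : 0 < Real.cos (k / 2) := cos_half_pos hk
  have hsq : √(1 - Real.sin (k / 2) ^ 2) = Real.cos (k / 2) := by
    rw [← Real.cos_sq', Real.sqrt_sq hc.le]
  have hcos : 1 - 2 * Real.sin (k / 2) ^ 2 = Real.cos k :=
    (cos_eq_one_sub_two_mul_sin_half_sq k).symm
  rw [smul_eq_mul, abs_of_pos (by positivity : 0 < Real.cos (k / 2) / 2), halfAngleIntegrand,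
    hsq, hcos, T_real_cos, srwHeatIntegrandReal]
  have hexp : Real.exp (-(2 * t * Real.sin (k / 2) ^ 2)) = Real.exp (-(t * (1 - Real.cos k))) := by
    rw [cos_eq_one_sub_two_mul_sin_half_sq k]; ring_nf
  rw [hexp, mul_comm (m : ℝ) k]
  field_simp

/-- **Half-angle form** of the continuous-time SRW kernel: for all `t : ℝ`, `m : ℤ`,
`q_t(m) = (2/π) ∫₀¹ e^{-2ts²} T_m(1-2s²) (1-s²)^{-1/2} ds` (`T_m` the Chebyshev polynomial of the
first kind; the integral is a set integral over `(0,1)`, where the integrand is integrable).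
[cite: FitznerVanDerHofstad2016NoBLE, §5.1.1 (5.2) p. 1089] -/
theorem srwHeatKernel_eq_integral_halfAngle (t : ℝ) (m : ℤ) :
    srwHeatKernel t m = 2 / π * ∫ s in Ioo (0 : ℝ) 1, halfAngleIntegrand t m s := by
  have hcv := integral_image_eq_integral_abs_deriv_smul (s := Ioo (0 : ℝ) π)
    (f := fun k : ℝ => Real.sin (k / 2)) (f' := fun k => Real.cos (k / 2) / 2) measurableSet_Ioo
    (fun k _ => by
      have h := (Real.hasDerivAt_sin (k / 2)).comp k ((hasDerivAt_id k).div_const 2)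
      have h2 : HasDerivAt (fun k : ℝ => Real.sin (k / 2)) (Real.cos (k / 2) / 2) k := by
        refine h.congr_deriv ?_
        ring
      exact h2.hasDerivWithinAt) injOn_sin_half (halfAngleIntegrand t m)
  rw [image_sin_half_Ioo] at hcv
  rw [hcv, setIntegral_congr_fun measurableSet_Ioo
    (fun k hk => abs_deriv_smul_halfAngleIntegrand (t := t) (m := m) hk), integral_const_mul,
    srwHeatKernel_eq_integral_zero_pi, intervalIntegral.integral_of_le Real.pi_pos.le,
    integral_Ioc_eq_integral_Ioo]
  field_simp

/-- The same with the `s`-integral written as an interval integral `∫ s in 0..1`. [cite: FitznerVanDerHofstad2016NoBLE, §5.1.1 (5.2) p. 1089] -/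
theorem srwHeatKernel_eq_intervalIntegral_halfAngle (t : ℝ) (m : ℤ) :
    srwHeatKernel t m = 2 / π * ∫ s in (0 : ℝ)..1, halfAngleIntegrand t m s := by
  rw [srwHeatKernel_eq_integral_halfAngle, intervalIntegral.integral_of_le zero_le_one,
    integral_Ioc_eq_integral_Ioo]

/-- The half-angle integrand `e^{-2ts²} T_m(1-2s²) (1-s²)^{-1/2}` is integrable on `(0,1)` (it is the
image of the continuous `k`-integrand under the change of variables). [folklore] -/
theorem integrableOn_halfAngleIntegrand (t : ℝ) (m : ℤ) :
    IntegrableOn (halfAngleIntegrand t m) (Ioo 0 1) := by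
  have h := integrableOn_image_iff_integrableOn_abs_deriv_smul (s := Ioo (0 : ℝ) π)
    (f := fun k : ℝ => Real.sin (k / 2)) (f' := fun k => Real.cos (k / 2) / 2) measurableSet_Ioo
    (fun k _ => by
      have h := (Real.hasDerivAt_sin (k / 2)).comp k ((hasDerivAt_id k).div_const 2)
      have h2 : HasDerivAt (fun k : ℝ => Real.sin (k / 2)) (Real.cos (k / 2) / 2) k := by
        refine h.congr_deriv ?_
        ring
      exact h2.hasDerivWithinAt) injOn_sin_half (halfAngleIntegrand t m)
  rw [image_sin_half_Ioo] at h
  rw [h]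
  have hI : IntegrableOn (fun k => (1 / 2 : ℝ) * srwHeatIntegrandReal t m k) (Ioo 0 π) :=
    ((continuous_srwHeatIntegrandReal t m).integrableOn_Icc.mono_set Ioo_subset_Icc_self).const_mul _
  exact hI.congr_fun (fun k hk => (abs_deriv_smul_halfAngleIntegrand hk).symm) measurableSet_Ioo

end Literature.Probability.LatticeModels
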